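import Literature.AnabelianGeometry.SemiGraphs.MetabelianLeafStarElevLevels
import HarnessLib

/-!
# `𝒢⋆(p)` is totally elevated; `Thm37Hypotheses 𝒢⋆(p)` HYPOTHESIS-FREE («RAYLESS-STAR·CIV-NEG», brick S4, part 4b)

Mochizuki, *Semi-graphs of anabelioids*, Publ. RIMS **42** (2006), Def. 2.4 (i) p. 25 ("elevated": for
every `M` a `π₁`-epimorphic approximator and a subgroup `N_M` of the approximating vertex group of order `≥ M`
meeting every conjugate of every branch image trivially), Thm. 3.7 p. 40 [cite: MochizukiSemiAnbd2006, Def 2.4(i) p.25].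

PROOF-ONLY file (abc-iut cell, layer L3, row «RAYLESS-STAR·CIV-NEG», seat abc-iut-L3-t8 gen 6; desk memo §6).
(H6) for the rayless counter-carrier `𝒢⋆(p) = metabelianLeafStar p`: at the index `e = M + 1` the approximator
`leafStarElevApproximator p e` (`MetabelianLeafStarElevLevels.lean`); at the CENTRE the elevation subgroup is the
powers of `b` (order `p^e`) in the commutative quotient `F̂₂⁽ᵖ⁾/ab⁻¹(p^e ℤ_p²)`, meeting the images of ALL the
branch groups `⟨a·b^{p^m}⟩‾` trivially; at the LEAF `n` it is the translations (order `p^e`), inside the normal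
kernel of the `u_n`-logarithm, which the torus image meets trivially.  With parts 1–3:
**`metabelianLeafStar_thm37Hypotheses'` — every hypothesis of [SemiAnbd] Thm 3.7 holds at `𝒢⋆(p)`, in the
kernel, with no binder left.**  No definition, no named fact; no side taken on [IUTchIII] Cor 3.12.
-/

noncomputable section

open scoped Pointwise
open Topology Multiplicative

namespace Literature.AnabelianGeometry.SemiGraphs

open IwahoriWitness

variable (p : ℕ) [hp : Fact p.Prime]

namespace ProfiniteSemiGraph

/-- **The centre of `𝒢⋆(p)` is elevated.** [cite: MochizukiSemiAnbd2006, Def 2.4(i) p.25] -/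
theorem metabelianLeafStar_isElevatedVertex_centre : (metabelianLeafStar p).IsElevatedVertex (leafStarCentre p) := by
  intro M
  let e : ℕ := M + 1
  set π : FreeProPRankTwo.Grp p →* (leafStarElevApproximator p e).FV (leafStarCentre p) :=
    (leafStarElevApproximator p e).πV (leafStarCentre p) with hπ
  have hker : ∀ x : FreeProPRankTwo.Grp p, π x = 1 ↔ x ∈ FreeProPRankTwo.abLevel p e :=
    fun x => leafStarElevApproximator_πV_eq_one_iff p e (leafStarCentre p) x
  have heq : ∀ x y : FreeProPRankTwo.Grp p, π x = π y ↔ x⁻¹ * y ∈ FreeProPRankTwo.abLevel p e :=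
    fun x y => leafStarElevApproximator_πV_eq_iff p e (leafStarCentre p) x y
  have hsurj : Function.Surjective π :=
    QuotientGroup.mk'_surjective (nN := leafStarElevLevel_normal p e _) (leafStarElevLevel p e (leafStarCentre p))
  have hpow : ∀ k : ℕ, π (FreeProPRankTwo.b p) ^ k = 1 ↔ p ^ e ∣ k := by
    intro k
    rw [← map_pow, hker]
    exact FreeProPRankTwo.b_pow_mem_abLevel_iff p e k
  have horder : orderOf (π (FreeProPRankTwo.b p)) = p ^ e := by
    apply orderOf_eq_prime_pow
    · rw [hpow]
      exact fun h => Nat.not_succ_le_self M ((Nat.pow_dvd_pow_iff_le_right hp.out.one_lt).1 h)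
    · rw [hpow]
  have hcomm : ∀ x y : (leafStarElevApproximator p e).FV (leafStarCentre p), x * y = y * x := by
    intro x y
    obtain ⟨x, rfl⟩ := hsurj x
    obtain ⟨y, rfl⟩ := hsurj y
    rw [← map_mul, ← map_mul, heq]
    exact FreeProPRankTwo.inv_mul_inv_mul_mem_abLevel p e x y
  refine ⟨leafStarElevApproximator p e, leafStarElevApproximator_isPiOneEpimorphic p e,
    Subgroup.zpowers (π (FreeProPRankTwo.b p)), ?_, ?_⟩
  · rw [Nat.card_zpowers, horder]
    exact (Nat.lt_pow_self hp.out.one_lt).le.trans (Nat.pow_le_pow_right hp.out.pos (Nat.le_succ M))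
  · intro b hb g
    have hmap : ((leafStarElevApproximator p e).brF b _ hb).range.map (MulAut.conj g).toMonoidHom =
        ((leafStarElevApproximator p e).brF b _ hb).range := by
      ext x
      constructor
      · rintro ⟨y, hy, rfl⟩
        have : (MulAut.conj g).toMonoidHom y = y := by
          change g * y * g⁻¹ = y
          rw [hcomm g y, mul_inv_cancel_right]
        rw [this]; exact hy
      · intro hx
        refine ⟨x, hx, ?_⟩
        change g * x * g⁻¹ = x
        rw [hcomm g x, mul_inv_cancel_right]
    rw [hmap, leafStarElevApproximator_range_brF, eq_bot_iff]
    obtain ⟨-, hB⟩ := starOfLeaves_branchSubgroup_none _ _ _ _ b hb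
    rintro z ⟨⟨k, rfl⟩, ⟨x, hx, hxz⟩⟩
    rw [Subgroup.mem_bot]
    dsimp only at hxz ⊢
    have hx' : x ∈ FreeProPRankTwo.An p b.1 := by
      have hx1 : x ∈ (FreeProPRankTwo.θα p b.1).toMonoidHom.range := hB ▸ hx
      rwa [FreeProPRankTwo.range_θα] at hx1
    change π x = π (FreeProPRankTwo.b p) ^ k at hxz
    -- reduce to a natural exponent
    have key : ∀ (k' : ℕ) (x' : FreeProPRankTwo.Grp p), x' ∈ FreeProPRankTwo.An p b.1 →
        π x' = π (FreeProPRankTwo.b p) ^ k' → π (FreeProPRankTwo.b p) ^ k' = 1 := by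
      intro k' x' hx'' hk'
      have h1 : π (FreeProPRankTwo.b p ^ k') = π x' := (map_pow π _ k').trans hk'.symm
      have hmem : (FreeProPRankTwo.b p ^ k')⁻¹ * x' ∈ FreeProPRankTwo.abLevel p e := (heq _ _).1 h1
      exact (hpow k').2 ((FreeProPRankTwo.b_pow_mem_abLevel_iff p e k').1
        (FreeProPRankTwo.b_pow_mem_abLevel_of_mem_An p e b.1 k' hx'' hmem))
    rcases Int.eq_nat_or_neg k with ⟨k', rfl | rfl⟩
    · have hk : π (FreeProPRankTwo.b p) ^ (k' : ℤ) = π (FreeProPRankTwo.b p) ^ k' := zpow_natCast _ k'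
      rw [hk] at hxz ⊢
      exact key k' x hx' hxz
    · have hk : π (FreeProPRankTwo.b p) ^ (-(k' : ℤ)) = (π (FreeProPRankTwo.b p) ^ k')⁻¹ := by
        rw [zpow_neg, zpow_natCast]
      rw [hk] at hxz ⊢
      rw [inv_eq_one]
      refine key k' x⁻¹ ((FreeProPRankTwo.An p b.1).inv_mem hx') ?_
      have hinv : π x⁻¹ = (π x)⁻¹ := map_inv π x
      rw [hinv, hxz, inv_inv]

/-- **Every leaf of `𝒢⋆(p)` is elevated.** [cite: MochizukiSemiAnbd2006, Def 2.4(i) p.25] -/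
theorem metabelianLeafStar_isElevatedVertex_leaf (n : ℕ) :
    (metabelianLeafStar p).IsElevatedVertex (leafStarLeaf p n) := by
  intro M
  let e : ℕ := M + 1
  set π : Iw.Leaf (p := p) n →* (leafStarElevApproximator p e).FV (leafStarLeaf p n) :=
    (leafStarElevApproximator p e).πV (leafStarLeaf p n) with hπ
  have hker : ∀ x : Iw.Leaf (p := p) n, π x = 1 ↔ x ∈ Iw.leafLevel (FreeProPRankTwo.elevEdgeLevel p e) n e :=
    fun x => leafStarElevApproximator_πV_eq_one_iff p e (leafStarLeaf p n) x
  have hsurj : Function.Surjective π :=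
    QuotientGroup.mk'_surjective (nN := leafStarElevLevel_normal p e _) (leafStarElevLevel p e (leafStarLeaf p n))
  have hlog1 : ∀ k : ℕ, Iw.logHom n (Iw.translLeaf (p := p) n ^ k) = 1 := by
    intro k
    have hproj : Iw.projC n (Iw.translLeaf (p := p) n) = 1 := by ext; rfl
    have h1 : Iw.logHom n (Iw.translLeaf (p := p) n) = 1 := by
      change (Iw.logC n) (Iw.projC n (Iw.translLeaf n)) = 1
      rw [hproj, map_one]
    rw [map_pow, h1, one_pow]
  have hpow : ∀ k : ℕ, π (Iw.translLeaf n) ^ k = 1 ↔ p ^ e ∣ k := by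
    intro k
    rw [← map_pow, hker, Iw.mem_leafLevel_iff, hlog1]
    simp only [Subgroup.one_mem, and_true]
    have hcoe : ((Iw.translLeaf (p := p) n ^ k : Iw.Leaf (p := p) n) : Iw p) = Iw.transl ^ k := by
      rw [Subgroup.coe_pow]; rfl
    rw [hcoe, Iw.transl_pow, Iw.toMod_eq_one_iff, norm_zero, PadicInt.norm_le_pow_iff_mem_span_pow,
      Ideal.mem_span_singleton, PadicIntLevels.pow_dvd_natCast_iff]
    exact ⟨fun h => h.1, fun h => ⟨h, zpow_nonneg (by exact_mod_cast hp.out.pos.le) _⟩⟩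
  have horder : orderOf (π (Iw.translLeaf n)) = p ^ e := by
    apply orderOf_eq_prime_pow
    · rw [hpow]
      exact fun h => Nat.not_succ_le_self M ((Nat.pow_dvd_pow_iff_le_right hp.out.one_lt).1 h)
    · rw [hpow]
  -- the logarithm modulo the edge level on the quotient
  have hkerle : Iw.leafLevel (FreeProPRankTwo.elevEdgeLevel p e) n e ≤
      ((QuotientGroup.mk' (FreeProPRankTwo.elevEdgeLevel p e)).comp (Iw.logHom (p := p) n)).ker := by
    intro x hx
    rw [MonoidHom.mem_ker, MonoidHom.comp_apply, QuotientGroup.mk'_apply, QuotientGroup.eq_one_iff]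
    exact ((Iw.mem_leafLevel_iff _ n e x).1 hx).2
  let lam : (leafStarElevApproximator p e).FV (leafStarLeaf p n) →*
      Multiplicative ℤ_[p] ⧸ FreeProPRankTwo.elevEdgeLevel p e :=
    QuotientGroup.lift (nN := leafStarElevLevel_normal p e _) (leafStarElevLevel p e (leafStarLeaf p n))
      ((QuotientGroup.mk' (FreeProPRankTwo.elevEdgeLevel p e)).comp (Iw.logHom (p := p) n)) hkerle
  have hlam : ∀ x : Iw.Leaf (p := p) n,
      lam (π x) = QuotientGroup.mk' (FreeProPRankTwo.elevEdgeLevel p e) (Iw.logHom n x) := fun x =>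
    QuotientGroup.lift_mk (nN := leafStarElevLevel_normal p e _) (leafStarElevLevel p e (leafStarLeaf p n)) hkerle x
  refine ⟨leafStarElevApproximator p e, leafStarElevApproximator_isPiOneEpimorphic p e,
    Subgroup.zpowers (π (Iw.translLeaf n)), ?_, ?_⟩
  · rw [Nat.card_zpowers, horder]
    exact (Nat.lt_pow_self hp.out.one_lt).le.trans (Nat.pow_le_pow_right hp.out.pos (Nat.le_succ M))
  · intro b hb g
    obtain ⟨hb', hB⟩ := starOfLeaves_branchSubgroup_some _ _ _ _ b n hb
    refine Subgroup.inf_map_conj_eq_bot_of_le_normal (K := lam.ker) ?_ ?_ g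
    · rw [Subgroup.zpowers_le, MonoidHom.mem_ker, hlam, ← pow_one (Iw.translLeaf (p := p) n), hlog1, map_one]
    · rw [leafStarElevApproximator_range_brF, eq_bot_iff]
      rintro z ⟨⟨x, hx, rfl⟩, hz⟩
      rw [Subgroup.mem_bot]
      have hx1 : x ∈ (Iw.lowHom (p := p) n).toMonoidHom.range := hB ▸ hx
      obtain ⟨t, rfl⟩ := hx1
      have hz' : lam (π (Iw.lowHom n t)) = 1 := hz
      rw [hlam, Iw.logHom_lowHom, QuotientGroup.mk'_apply, QuotientGroup.eq_one_iff] at hz'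
      change π (Iw.lowHom n t) = 1
      rw [hker]
      have ht : t ∈ (Iw.leafLevel (FreeProPRankTwo.elevEdgeLevel p e) n e).comap
          (Iw.lowHom (p := p) n).toMonoidHom := by
        rw [Iw.comap_lowHom_leafLevel _ (fun t ht => (FreeProPRankTwo.mem_elevEdgeLevel_iff p e t).1 ht) n]
        exact hz'
      exact ht

/-- **(H6) `𝒢⋆(p)` is TOTALLY ELEVATED.** [cite: MochizukiSemiAnbd2006, Def 2.4(i) p.25] -/
theorem metabelianLeafStar_isTotallyElevated : (metabelianLeafStar p).IsTotallyElevated := by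
  intro v
  cases v with
  | none => exact metabelianLeafStar_isElevatedVertex_centre p
  | some n => exact metabelianLeafStar_isElevatedVertex_leaf p n

/-- **`Thm37Hypotheses 𝒢⋆(p)`, HYPOTHESIS-FREE**: the rayless counter-carrier satisfies every standing hypothesis
of [SemiAnbd] Thm 3.7 (connected, countable, Galois-countable, a vertex, injective type, quasi-coherent,
totally elevated, totally aloof, verticially slim, totally estranged) — in the kernel.
[cite: MochizukiSemiAnbd2006, Thm 3.7 p.40] -/
theorem metabelianLeafStar_thm37Hypotheses' : (metabelianLeafStar p).Thm37Hypotheses :=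
  metabelianLeafStar_thm37Hypotheses p (metabelianLeafStar_isGaloisCountable p)
    (metabelianLeafStar_isQuasiCoherent p) (metabelianLeafStar_isTotallyElevated p)

end ProfiniteSemiGraph

end Literature.AnabelianGeometry.SemiGraphs

end
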